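import Summits.AtomisticToContinuum.BoseEinsteinCondensation.Theorems.GaussianDominationCan.Negative.CruxForms
import Summits.AtomisticToContinuum.BoseEinsteinCondensation.Theorems.GaussianDominationCan.Negative.Structure
import Literature.MathematicalPhysics.QuantumManyBody.PeriodicBoseGasFourier
import Literature.MathematicalPhysics.QuantumManyBody.PeriodicBoseGasFracEnergy
import Literature.MathematicalPhysics.QuantumManyBody.OneBodyCurrentGain
import HarnessLib

/-!
# Route `BECThomsonPrinciple`, crux `GaussianDominationCan` (stmt-AtomisticToContinuum-9479),
# line `coupling-monotone-chord` — stub `stub_modeBessel` (A1)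

The registered stub A1 of the skeleton `Cruxes/GaussianDominationCan/Lines/coupling-monotone-chord.lean`
(statement `ModeBessel` of `Theorems/BECThomsonPrincipleGaussianDominationCanDefs.lean`, stated here
verbatim in the landed vocabulary `Negative.ProductCalculus` — `cellAvg`, `phase`, `nsq`): the
one-mode gradient Bessel inequality with Bose symmetry,

  `N · |k|² · ∫_{cell^N} |ĉ_k(X)|² dX ≤ ∫_{cell^N} |∇Φ|²`,  `|k|² = (2π/L)² ∑ⱼ nⱼ²`, `N = m + 1`,

where `ĉ_k(X) = L⁻³ ∫_cell conj(e^{ik·y}) Φ(y, X̂₀) dy` is the crux's cell average `P₀` applied to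
`conj(e^{ik·x₀})·Φ` (the `k`-mode coefficient of particle `0` given the bath; `T ≥ |k|² ⟨n_k⟩`).

Proof: on the fibre `X = (x, Y)` the cell average is the cell Fourier coefficient
`cellFourierCoeff L (y ↦ Φ(y, Y)) n` of the slice (`cellFourierCoeff_eq_integral`,
`phase_eq_cellWave`), so that `L³ |ĉ_k|²` is the slice inner product with the normalised plane wave
`planeWaveMode L n` (`nnnorm_sq_integral_conj_planeWaveMode_mul`), and after the `x`-integration
(`lintegral_cellN_succ`, the integrand does not depend on `x`) the left-hand side is exactly the
`p = n` term `|k|² ⟨φ_n, γ_Φ φ_n⟩` (`fracDispersion 2 L n * cellOccupation N L (planeWaveMode L n) Φ`,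
`cellOccupation_succ`, `fracDispersion_two`) of the gradient Parseval identity in the traced variable
`∑_p |2πp/L|² ⟨φ_p, γ_Φ φ_p⟩ = ∫_{cell^N} |∇Φ|²` (`tsum_fracDispersion_two_mul_cellOccupation` of
`PeriodicBoseGasFracEnergy.lean`, which packages the slice-wise `tsum_sq_grad_cellFourierCoeff`,
Tonelli and the Bose symmetry `N ∫|∇₀Φ|² = ∑ᵢ ∫|∇ᵢΦ|²`); a single term is at most the sum
(`ENNReal.le_tsum`).

References: E. H. Lieb, R. Seiringer, J. P. Solovej, J. Yngvason, *The Mathematics of the Bose Gas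
and its Condensation* (2005), §1.2 (1.16)–(1.18) (one-particle density matrix, `tr γ|k|²`); folklore.
-/

noncomputable section

namespace Summit.AtomisticToContinuum.BoseEinsteinCondensation.Cruxes.GaussianDominationCan.CouplingMonotoneChord

open MeasureTheory
open scoped ENNReal NNReal ComplexConjugate
open Literature.MathematicalPhysics.QuantumManyBody.BoseGas
open Summit.AtomisticToContinuum.BoseEinsteinCondensation.Theorems.GaussianDominationCan.Negative

/-- **The fibre identity.** On the fibre `X = (x, Y)` the crux's cell average `P₀` of
`conj(e^{ik·x₀})·ψ` is the `n`-th cell Fourier coefficient of the slice `y ↦ ψ(y, Y)`: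
`L⁻³ ∫_cell conj(e_n(y)) ψ(y, Y) dy = ĉ_n(ψ(·, Y))` (independent of `x`). [folklore] -/
theorem cellAvg_conj_phase_mul_vecCons {m : ℕ} {L : ℝ} (hL : 0 < L) (n : Fin 3 → ℤ)
    (ψ : Config (m + 1) → ℂ) (x : Space) (Y : Config m) :
    cellAvg (m + 1) L 0 (fun Z => conj (phase m L n Z) * ψ Z) (Matrix.vecCons x Y) =
      cellFourierCoeff L (fun y => ψ (Matrix.vecCons y Y)) n := by
  rw [cellFourierCoeff_eq_integral hL]
  unfold cellAvg
  congr 1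
  refine setIntegral_congr_fun (measurableSet_cell L) fun y _ => ?_
  have hupd : Function.update (Matrix.vecCons x Y) 0 y = Matrix.vecCons y Y :=
    Fin.update_cons_zero (α := fun _ => Space) x Y y
  simp only [hupd, phase_eq_cellWave, Matrix.cons_val_zero]

/-- **Stub A1 `stub_modeBessel`** (statement `ModeBessel` of the line's `Defs` file, verbatim):
one-mode gradient Bessel inequality + Bose symmetry,
`N · (4π² ∑ⱼnⱼ² / L²) · ∫_{cell^N} |P₀(conj(e^{ik·x₀}) Φ)|² ≤ ∫_{cell^N} |∇Φ|²` for every periodic Bose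
trial state `Φ` of `N = m + 1` particles on the torus of side `L > 0` and every `n ∈ ℤ³` — the
`p = n` term of `∑_p |2πp/L|² ⟨φ_p, γ_Φ φ_p⟩ = ⟨Φ, ∑ᵢ(-Δᵢ)Φ⟩`. [folklore] -/
theorem stub_modeBessel :
    ∀ m : ℕ, ∀ L : ℝ, 0 < L → ∀ n : Fin 3 → ℤ, ∀ Φ : PeriodicTrialState (m + 1) L,
      ENNReal.ofReal ((m + 1 : ℝ) * (4 * Real.pi ^ 2 * nsq n / L ^ 2)) *
          ∫⁻ X in cellN (m + 1) L,
            (‖cellAvg (m + 1) L 0 (fun Y => (starRingEnd ℂ) (phase m L n Y) * Φ.ψ Y) X‖₊ : ℝ≥0∞) ^ 2 ≤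
        ∫⁻ X in cellN (m + 1) L, kineticDensity Φ.ψ X := by
  intro m L hL n Φ
  rw [← tsum_fracDispersion_two_mul_cellOccupation hL Φ]
  refine le_trans (le_of_eq ?_) (ENNReal.le_tsum n)
  -- the integrand `|P₀(conj(e^{ik·x₀}) Φ)|²` is measurable (continuous)
  have hph : Continuous fun Z : Config (m + 1) => phase m L n Z := by
    simp_rw [phase_eq_cellWave]
    exact (contDiff_cellWave L n).continuous.comp (continuous_apply 0)
  have hg : Continuous fun Z : Config (m + 1) => conj (phase m L n Z) * Φ.ψ Z :=
    (Complex.continuous_conj.comp hph).mul Φ.contDiff.continuous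
  have hF : Measurable fun X : Config (m + 1) =>
      (‖cellAvg (m + 1) L 0 (fun Z => conj (phase m L n Z) * Φ.ψ Z) X‖₊ : ℝ≥0∞) ^ 2 :=
    (continuous_cellAvg 0 hg).measurable.nnnorm.coe_nnreal_ennreal.pow_const _
  -- split off particle `0` and evaluate the fibre
  rw [lintegral_cellN_succ L hF]
  simp only [cellAvg_conj_phase_mul_vecCons hL, setLIntegral_const, volume_cell]
  rw [cellOccupation_succ, fracDispersion_two]
  simp only [nnnorm_sq_integral_conj_planeWaveMode_mul hL]
  -- bookkeeping of the constants
  have hm : ENNReal.ofReal ((m + 1 : ℝ) * (4 * Real.pi ^ 2 * nsq n / L ^ 2)) =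
      (m + 1 : ℝ≥0∞) * ENNReal.ofReal (4 * Real.pi ^ 2 * nsq n / L ^ 2) := by
    rw [ENNReal.ofReal_mul (by positivity), show ((m : ℝ) + 1) = ((m + 1 : ℕ) : ℝ) by push_cast; ring,
      ENNReal.ofReal_natCast]
    push_cast
    rfl
  rw [hm]
  simp_rw [mul_comm _ (ENNReal.ofReal L ^ 3)]
  unfold nsq
  ring
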